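import Summits.BirchSwinnertonDyer.BirchSwinnertonDyer.Theorems.ManinLocalTwoThreeManinOfStevensConjectures
import Summits.BirchSwinnertonDyer.BirchSwinnertonDyer.Theorems.ManinLocalTwoThreeShimuraRationalThreeIsogeny
import HarnessLib

/-!
# Manin's conjecture `c₀ = ±1` at the levels `N = 4p` and `N = 9p` from STEVENS' conjectures I and II alone

Summit `BirchSwinnertonDyer`, route `ManinLocalTwoThree` (cell bsd-f2-manin), cruxes C2 `ManinOddAtFour` (stmt-BirchSwinnertonDyer-22967) and
C3 `ManinPrimeToThreeAtNine` (stmt-BirchSwinnertonDyer-22968); lead p1 gen 14.  Corollaries BY NAME of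
`…ManinOfStevensConjectures` (C2/C3 ⟸ F-need ∧ Stevens I ∧ Stevens II ∧ index exclusion) at the levels where the index exclusion is
already a THEOREM of the tree:

* `N = 4q`, `q` odd with `(ℤ/q)ˣ` cyclic (in particular `N = 4p`, `p` an odd prime — the levels of the tame blind family `p = m² + 4`):
  `not_periodLatticeGamma1_eq_two_mul_of_four_mul` (`Λ₁(f) ≠ 2Λ₀(f)`), hence
  `natAbs_maninConstant₀_eq_one_of_stevensConjectures_four_mul` — **Stevens I (`c₁ = ±1`) ∧ Stevens II (maximal Néron covolume of the
  Stevens curve) ⟹ `|c₀| = 1`** for every lattice-optimal `X₀(4q)`-datum isogenous to a Stevens datum, and `2 ∤ c₀`;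
* `N = 9q`, `3 ∤ q`, `(ℤ/q)ˣ` cyclic of order prime to `3` (in particular `N = 9p`, `p ≡ 2 (mod 3)` prime):
  `not_periodLatticeGamma1_eq_three_mul_of_nine_mul` (`Λ₁(f) ≠ 3Λ₀(f)`), hence
  `natAbs_maninConstant₀_eq_one_of_stevensConjectures_nine_mul` — **Stevens I ∧ Stevens II ⟹ `|c₀| = 1`**, and `3 ∤ c₀`;
* the `hex` forms (`…_of_exists`) take the Stevens datum from F-need `exists_optimal_gamma1ParametrizationData`.

So at these levels the whole of Manin's conjecture for lattice-optimal `X₀(N)`-data is a consequence of Stevens' two 1989 conjectures and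
F-need, with no cell law.  HONEST FRAMING: CONDITIONAL theorems — Stevens' Conjectures I/II are OPEN (tree: plain predicates
`ManinConstant.StevensConstantOne`, `KatoCurve.IsMaxCovolumeInClass`, nothing asserted), F-need is statement-only; BSD is not proved;
Manin's conjecture is not proved; C2/C3 OPEN.  No definitions, no named facts, no sorry.
[cite: Stevens1989, Conjectures I–III, Thm. 2.3]
-/

set_option autoImplicit false
-- the summit-side namespace `Summit.BirchSwinnertonDyer.BirchSwinnertonDyer.…` is the tree's (summit = sub-problem)
set_option linter.dupNamespace false

noncomputable section

open scoped Classical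
open WeierstrassCurve Literature.NumberTheory.EllipticCurves Literature.NumberTheory.EllipticCurves.ModularForms
open CongruenceSubgroup
open Summit.BirchSwinnertonDyer.Rank1Residual.ManinAdditive.ShimuraKernel
open Summit.BirchSwinnertonDyer.Rank1Residual.ManinAdditive.KatoCurve
open Summit.BirchSwinnertonDyer.Rank1Residual.ManinConstant

namespace Summit.BirchSwinnertonDyer.BirchSwinnertonDyer.Theorems.ManinLocalTwoThree

variable {W₁ W₀ : WeierstrassCurve ℚ} [W₁.IsElliptic] [W₁.IsGloballyMinimal] [W₀.IsElliptic]
  [W₀.IsGloballyMinimal]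

/-! ## §0 Stevens I in `natAbs` form -/

omit [W₀.IsElliptic] [W₀.IsGloballyMinimal] in
/-- Stevens I `StevensConstantOne` (`|c₁| = 1` for optimal `X₁(N)`-data) in the form `c₁.natAbs = 1`. [cite: Stevens1989, Conjecture I] -/
theorem natAbs_maninConstant_eq_one_of_stevensConstantOne (hSt1 : StevensConstantOne) {N : ℕ} [NeZero N]
    (D₁ : Gamma1ParametrizationData W₁ N) (h₁ : D₁.IsOptimal) : D₁.maninConstant.natAbs = 1 := by
  have h1 : |D₁.maninConstant| = 1 := hSt1 W₁ D₁ h₁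
  have := Int.abs_eq_natAbs D₁.maninConstant
  rw [h1] at this
  exact_mod_cast this.symm

/-! ## §1 `N = 4q`: Manin's `c₀ = ±1` from Stevens I ∧ II -/

/-- **At `N = 4q` (`q` odd, `(ℤ/q)ˣ` cyclic): Stevens II for the Stevens curve ⟹ `|c₀| = |c₁|`.**  The index-`4` configuration is excluded
at these levels (`not_periodLatticeGamma1_eq_two_mul_of_four_mul`), so `natAbs_maninConstant₀_eq_of_maxCovolume_of_index_ne_four` applies.
CONDITIONAL on Stevens II (hypothesis `hmax`). [cite: Stevens1989, Conjecture II, Thm. 2.3] -/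
theorem natAbs_maninConstant₀_eq_of_maxCovolume_four_mul {q : ℕ} (hq : Odd q) [IsCyclic (ZMod q)ˣ] [NeZero (4 * q)]
    (D₁ : Gamma1ParametrizationData W₁ (4 * q)) (D₀ : ModularParametrizationData W₀ (4 * q))
    (hiso : IsIsogenous W₁ W₀) (h₁ : D₁.IsOptimal)
    (h₀ : ∀ z ∈ D₀.L.lattice, ∃ w ∈ periodLattice D₀.f, z = D₀.c * w) (hmax : IsMaxCovolumeInClass W₁) :
    D₀.maninConstant.natAbs = D₁.maninConstant.natAbs :=
  natAbs_maninConstant₀_eq_of_maxCovolume_of_index_ne_four D₁ D₀ hiso h₁ h₀ ⟨q, by norm_num⟩ hmax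
    (not_periodLatticeGamma1_eq_two_mul_of_four_mul hq D₀ h₀)

/-- **At `N = 4q` (`q` odd, `(ℤ/q)ˣ` cyclic): Stevens I ∧ Stevens II ⟹ Manin's `|c₀| = 1`** for a lattice-optimal `X₀(4q)`-datum
isogenous to an optimal `X₁(4q)`-datum.  CONDITIONAL (both conjectures OPEN); BSD not proved. [cite: Stevens1989, Conjectures I–II] -/
theorem natAbs_maninConstant₀_eq_one_of_stevensConjectures_four_mul {q : ℕ} (hq : Odd q) [IsCyclic (ZMod q)ˣ]
    [NeZero (4 * q)] (D₁ : Gamma1ParametrizationData W₁ (4 * q)) (D₀ : ModularParametrizationData W₀ (4 * q))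
    (hiso : IsIsogenous W₁ W₀) (h₁ : D₁.IsOptimal)
    (h₀ : ∀ z ∈ D₀.L.lattice, ∃ w ∈ periodLattice D₀.f, z = D₀.c * w) (hSt1 : StevensConstantOne)
    (hmax : IsMaxCovolumeInClass W₁) : D₀.maninConstant.natAbs = 1 := by
  rw [natAbs_maninConstant₀_eq_of_maxCovolume_four_mul hq D₁ D₀ hiso h₁ h₀ hmax]
  exact natAbs_maninConstant_eq_one_of_stevensConstantOne hSt1 D₁ h₁

/-- **Prime form, `N = 4p` (`p` an odd prime): Stevens I ∧ Stevens II ⟹ `|c₀| = 1`.** CONDITIONAL. [cite: Stevens1989, Conjectures I–II] -/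
theorem natAbs_maninConstant₀_eq_one_of_stevensConjectures_four_mul_prime {p : ℕ} (hp : p.Prime) (hp2 : p ≠ 2)
    [NeZero (4 * p)] (D₁ : Gamma1ParametrizationData W₁ (4 * p)) (D₀ : ModularParametrizationData W₀ (4 * p))
    (hiso : IsIsogenous W₁ W₀) (h₁ : D₁.IsOptimal)
    (h₀ : ∀ z ∈ D₀.L.lattice, ∃ w ∈ periodLattice D₀.f, z = D₀.c * w) (hSt1 : StevensConstantOne)
    (hmax : IsMaxCovolumeInClass W₁) : D₀.maninConstant.natAbs = 1 := by
  haveI : IsCyclic (ZMod p)ˣ := ZMod.isCyclic_units_prime hp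
  exact natAbs_maninConstant₀_eq_one_of_stevensConjectures_four_mul (hp.odd_of_ne_two hp2) D₁ D₀ hiso h₁ h₀ hSt1 hmax

/-- **C2 at `N = 4p` from Stevens I ∧ II**: `2 ∤ c₀` (indeed `|c₀| = 1`). CONDITIONAL; C2 OPEN. [cite: Stevens1989, Conjectures I–II] -/
theorem not_two_dvd_maninConstant₀_of_stevensConjectures_four_mul_prime {p : ℕ} (hp : p.Prime) (hp2 : p ≠ 2)
    [NeZero (4 * p)] (D₁ : Gamma1ParametrizationData W₁ (4 * p)) (D₀ : ModularParametrizationData W₀ (4 * p))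
    (hiso : IsIsogenous W₁ W₀) (h₁ : D₁.IsOptimal)
    (h₀ : ∀ z ∈ D₀.L.lattice, ∃ w ∈ periodLattice D₀.f, z = D₀.c * w) (hSt1 : StevensConstantOne)
    (hmax : IsMaxCovolumeInClass W₁) : ¬ (2 : ℤ) ∣ D₀.maninConstant := by
  intro h2
  have h2' : (2 : ℤ).natAbs ∣ D₀.maninConstant.natAbs := Int.natAbs_dvd_natAbs.mpr h2
  rw [natAbs_maninConstant₀_eq_one_of_stevensConjectures_four_mul_prime hp hp2 D₁ D₀ hiso h₁ h₀ hSt1 hmax] at h2'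
  norm_num at h2'

omit [W₁.IsElliptic] [W₁.IsGloballyMinimal] in
/-- **`N = 4p`, F-need form: F-need ∧ Stevens I ∧ Stevens II (for Stevens data of level `4p`) ⟹ `|c₀| = 1` for EVERY lattice-optimal
`X₀(4p)`-datum** — Manin's conjecture at these levels, conditionally. BSD not proved. [cite: Stevens1989, Conjectures I–II] -/
theorem natAbs_maninConstant₀_eq_one_of_stevensConjectures_four_mul_prime_of_exists {p : ℕ} (hp : p.Prime) (hp2 : p ≠ 2)
    [NeZero (4 * p)] (hex : exists_optimal_gamma1ParametrizationData) (hSt1 : StevensConstantOne)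
    (hSt2 : ∀ (W₁ : WeierstrassCurve ℚ) [W₁.IsElliptic] [W₁.IsGloballyMinimal]
      (D₁ : Gamma1ParametrizationData W₁ (4 * p)), D₁.IsOptimal → IsMaxCovolumeInClass W₁)
    (D₀ : ModularParametrizationData W₀ (4 * p))
    (h₀ : ∀ z ∈ D₀.L.lattice, ∃ w ∈ periodLattice D₀.f, z = D₀.c * w) : D₀.maninConstant.natAbs = 1 := by
  obtain ⟨W₁, _, _, D₁, hiso, h₁⟩ := hex W₀ D₀ h₀
  exact natAbs_maninConstant₀_eq_one_of_stevensConjectures_four_mul_prime hp hp2 D₁ D₀ hiso h₁ h₀ hSt1 (hSt2 W₁ D₁ h₁)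

/-! ## §2 `N = 9q`: Manin's `c₀ = ±1` from Stevens I ∧ II -/

/-- **At `N = 9q` (`3 ∤ q`, `(ℤ/q)ˣ` cyclic of order prime to `3`): Stevens II for the Stevens curve ⟹ `|c₀| = |c₁|`.**  Tripling
`|c₀| = 3|c₁|` would force `Λ₁(f) = 3Λ₀(f)` (`index_nine_of_maxCovolume_of_natAbs_eq_three_mul`), excluded at these levels
(`not_periodLatticeGamma1_eq_three_mul_of_nine_mul`). CONDITIONAL on Stevens II. [cite: Stevens1989, Conjecture II, Thm. 2.3] -/
theorem natAbs_maninConstant₀_eq_of_maxCovolume_nine_mul {q : ℕ} [NeZero q] (hq : Nat.Coprime 3 q) [IsCyclic (ZMod q)ˣ]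
    (hcard : Nat.Coprime 3 (Fintype.card (ZMod q)ˣ)) [NeZero (9 * q)]
    (D₁ : Gamma1ParametrizationData W₁ (9 * q)) (D₀ : ModularParametrizationData W₀ (9 * q))
    (hiso : IsIsogenous W₁ W₀) (h₁ : D₁.IsOptimal)
    (h₀ : ∀ z ∈ D₀.L.lattice, ∃ w ∈ periodLattice D₀.f, z = D₀.c * w) (hmax : IsMaxCovolumeInClass W₁) :
    D₀.maninConstant.natAbs = D₁.maninConstant.natAbs := by
  have h9 : 3 ^ 2 ∣ 9 * q := ⟨q, by norm_num⟩
  rcases natAbs_maninConstant₀_eq_or_eq_three_mul_of_nine_dvd_level D₁ D₀ hiso h₁ h₀ h9 with h | h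
  · exact h
  · exact absurd (index_nine_of_maxCovolume_of_natAbs_eq_three_mul D₁ D₀ hiso h₀ h9 hmax h)
      (not_periodLatticeGamma1_eq_three_mul_of_nine_mul hq hcard D₀ h₀)

/-- **At `N = 9q` (`3 ∤ q`, `(ℤ/q)ˣ` cyclic of order prime to `3`): Stevens I ∧ Stevens II ⟹ Manin's `|c₀| = 1`.** CONDITIONAL;
BSD not proved. [cite: Stevens1989, Conjectures I–II] -/
theorem natAbs_maninConstant₀_eq_one_of_stevensConjectures_nine_mul {q : ℕ} [NeZero q] (hq : Nat.Coprime 3 q)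
    [IsCyclic (ZMod q)ˣ] (hcard : Nat.Coprime 3 (Fintype.card (ZMod q)ˣ)) [NeZero (9 * q)]
    (D₁ : Gamma1ParametrizationData W₁ (9 * q)) (D₀ : ModularParametrizationData W₀ (9 * q))
    (hiso : IsIsogenous W₁ W₀) (h₁ : D₁.IsOptimal)
    (h₀ : ∀ z ∈ D₀.L.lattice, ∃ w ∈ periodLattice D₀.f, z = D₀.c * w) (hSt1 : StevensConstantOne)
    (hmax : IsMaxCovolumeInClass W₁) : D₀.maninConstant.natAbs = 1 := by
  rw [natAbs_maninConstant₀_eq_of_maxCovolume_nine_mul hq hcard D₁ D₀ hiso h₁ h₀ hmax]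
  exact natAbs_maninConstant_eq_one_of_stevensConstantOne hSt1 D₁ h₁

/-- **Prime form, `N = 9p` (`p` prime, `p ≡ 2 (mod 3)`): Stevens I ∧ Stevens II ⟹ `|c₀| = 1`.** CONDITIONAL. [cite: Stevens1989, Conjectures I–II] -/
theorem natAbs_maninConstant₀_eq_one_of_stevensConjectures_nine_mul_prime {p : ℕ} (hp : p.Prime) (hp3 : p % 3 = 2)
    [NeZero (9 * p)] (D₁ : Gamma1ParametrizationData W₁ (9 * p)) (D₀ : ModularParametrizationData W₀ (9 * p))
    (hiso : IsIsogenous W₁ W₀) (h₁ : D₁.IsOptimal)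
    (h₀ : ∀ z ∈ D₀.L.lattice, ∃ w ∈ periodLattice D₀.f, z = D₀.c * w) (hSt1 : StevensConstantOne)
    (hmax : IsMaxCovolumeInClass W₁) : D₀.maninConstant.natAbs = 1 := by
  haveI : NeZero p := ⟨hp.ne_zero⟩
  haveI : Fact p.Prime := ⟨hp⟩
  haveI : IsCyclic (ZMod p)ˣ := ZMod.isCyclic_units_prime hp
  have h3p : Nat.Coprime 3 p := (Nat.coprime_primes Nat.prime_three hp).2 (by rintro rfl; norm_num at hp3)
  refine natAbs_maninConstant₀_eq_one_of_stevensConjectures_nine_mul h3p ?_ D₁ D₀ hiso h₁ h₀ hSt1 hmax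
  rw [ZMod.card_units p]
  have h1 : (p - 1) % 3 = 1 := by have := hp.two_le; omega
  rw [Nat.Coprime, Nat.gcd_rec, h1]
  rfl

/-- **C3 at `N = 9p` (`p ≡ 2 (mod 3)`) from Stevens I ∧ II**: `3 ∤ c₀` (indeed `|c₀| = 1`). CONDITIONAL; C3 OPEN. [cite: Stevens1989, Conjectures I–II] -/
theorem not_three_dvd_maninConstant₀_of_stevensConjectures_nine_mul_prime {p : ℕ} (hp : p.Prime) (hp3 : p % 3 = 2)
    [NeZero (9 * p)] (D₁ : Gamma1ParametrizationData W₁ (9 * p)) (D₀ : ModularParametrizationData W₀ (9 * p))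
    (hiso : IsIsogenous W₁ W₀) (h₁ : D₁.IsOptimal)
    (h₀ : ∀ z ∈ D₀.L.lattice, ∃ w ∈ periodLattice D₀.f, z = D₀.c * w) (hSt1 : StevensConstantOne)
    (hmax : IsMaxCovolumeInClass W₁) : ¬ (3 : ℤ) ∣ D₀.maninConstant := by
  intro h3
  have h3' : (3 : ℤ).natAbs ∣ D₀.maninConstant.natAbs := Int.natAbs_dvd_natAbs.mpr h3
  rw [natAbs_maninConstant₀_eq_one_of_stevensConjectures_nine_mul_prime hp hp3 D₁ D₀ hiso h₁ h₀ hSt1 hmax] at h3'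
  norm_num at h3'

omit [W₁.IsElliptic] [W₁.IsGloballyMinimal] in
/-- **`N = 9p` (`p ≡ 2 (mod 3)`), F-need form: F-need ∧ Stevens I ∧ Stevens II (for Stevens data of level `9p`) ⟹ `|c₀| = 1` for EVERY
lattice-optimal `X₀(9p)`-datum.** CONDITIONAL; BSD not proved. [cite: Stevens1989, Conjectures I–II] -/
theorem natAbs_maninConstant₀_eq_one_of_stevensConjectures_nine_mul_prime_of_exists {p : ℕ} (hp : p.Prime) (hp3 : p % 3 = 2)
    [NeZero (9 * p)] (hex : exists_optimal_gamma1ParametrizationData) (hSt1 : StevensConstantOne)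
    (hSt2 : ∀ (W₁ : WeierstrassCurve ℚ) [W₁.IsElliptic] [W₁.IsGloballyMinimal]
      (D₁ : Gamma1ParametrizationData W₁ (9 * p)), D₁.IsOptimal → IsMaxCovolumeInClass W₁)
    (D₀ : ModularParametrizationData W₀ (9 * p))
    (h₀ : ∀ z ∈ D₀.L.lattice, ∃ w ∈ periodLattice D₀.f, z = D₀.c * w) : D₀.maninConstant.natAbs = 1 := by
  obtain ⟨W₁, _, _, D₁, hiso, h₁⟩ := hex W₀ D₀ h₀
  exact natAbs_maninConstant₀_eq_one_of_stevensConjectures_nine_mul_prime hp hp3 D₁ D₀ hiso h₁ h₀ hSt1 (hSt2 W₁ D₁ h₁)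

end Summit.BirchSwinnertonDyer.BirchSwinnertonDyer.Theorems.ManinLocalTwoThree

end
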